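import Mathlib
import HarnessLib

/-!
# Heath-Brown's conic bound, I: two approximate roots of a binary quadratic congruence

Auxiliary file (theorems only, no definitions) for the proof of
`Literature.NumberTheory.DiophantineGeometry.TernaryConicPointBound` (D. R. Heath-Brown, *The density
of rational points on curves and surfaces*, Ann. of Math. 155 (2002), Corollary 2, key
`Heathbrown2002`), discharged in `TernaryConicPointBoundProofs`.

This file is the BINARY step of the local input at a prime `q` dividing the determinant
(the classical treatment of `h(t) = a t² + 2 b t + d ≡ 0 (mod q^n)` near a root of multiplicity
two modulo `q`), for `H(u₀,u₁) = a u₀² + 2b u₀u₁ + d u₁²` with `b² - ad = q^e D₀`, `q ∤ D₀`: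
if `q^n ∣ H(u)` with `n > e` and `u₁` a `q`-unit, completing the square
`a H(u) = w² - (b² - ad) u₁²`, `w = a u₀ + b u₁`, forces `w = q^{e/2} ω` with `ω/u₁` a square
root of `D₀` modulo `q` (`exists_eq_pow_mul_of_sq_congr`); the polar identity
`H(u) v₁² - H(v) u₁² = (u₀v₁ - v₀u₁)(v₁ w(u) + u₁ w(v))` then gives
`q^{n - e/2 - [q=2]} ∣ u₀v₁ - v₀u₁` (`binary_minor_dvd`) as soon as `v₁ ω(u) + u₁ ω(v)` has the
least possible `q`-valuation `[q = 2]`, which is what the equality of the one-bit data `rootBit`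
(which square root; the residue modulo `4` when `q = 2`) guarantees (`sum_eq_of_rootBit_eq`).
No definition is introduced: the bit is a bound function `bit` with a defining hypothesis.
The model classes built on this are in `TernaryConicLocalClasses`.

## References

* D. R. Heath-Brown, Ann. of Math. 155 (2002), Corollary 2 and §3 [Heathbrown2002]; D. R. Heath-Brown,
  *The density of rational points on cubic surfaces*, Acta Arith. 79 (1997), proof of Theorem 2 (the
  local lattices at the primes of `Δ`).
-/

namespace Literature.NumberTheory.DiophantineGeometry

namespace TernaryConic

/-! ### Algebraic identities for `H(u₀,u₁) = a u₀² + 2b u₀u₁ + d u₁²` -/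

/-- The polar identity `H(u) v₁² - H(v) u₁² = (u₀v₁ - v₀u₁)(v₁ (a u₀ + b u₁) + u₁ (a v₀ + b v₁))`.
[folklore] -/
theorem binary_polar_identity (a b d u₀ u₁ v₀ v₁ : ℤ) :
    (a * u₀ ^ 2 + 2 * b * u₀ * u₁ + d * u₁ ^ 2) * v₁ ^ 2
        - (a * v₀ ^ 2 + 2 * b * v₀ * v₁ + d * v₁ ^ 2) * u₁ ^ 2
      = (u₀ * v₁ - v₀ * u₁) * (v₁ * (a * u₀ + b * u₁) + u₁ * (a * v₀ + b * v₁)) := by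
  ring

/-- Completing the square: `a H(u) = (a u₀ + b u₁)² - (b² - a d) u₁²`. [folklore] -/
theorem binary_complete_square (a b d u₀ u₁ : ℤ) :
    a * (a * u₀ ^ 2 + 2 * b * u₀ * u₁ + d * u₁ ^ 2)
      = (a * u₀ + b * u₁) ^ 2 - (b ^ 2 - a * d) * u₁ ^ 2 := by
  ring

/-! ### Valuation of an approximate square root -/

/-- If `q^n ∣ w² - q^e D₀ u²` with `e < n` and `q ∤ D₀ u`, then `e` is even, `w = q^{e/2} ω` with
`q ∤ ω`, and `ω² ≡ D₀ u² (mod q)`. [folklore] -/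
theorem exists_eq_pow_mul_of_sq_congr {q : ℕ} (hq : q.Prime) {e n : ℕ} (hen : e < n) {w D₀ u : ℤ}
    (hD₀ : ¬ (q : ℤ) ∣ D₀) (hu : ¬ (q : ℤ) ∣ u)
    (h : (q : ℤ) ^ n ∣ w ^ 2 - (q : ℤ) ^ e * D₀ * u ^ 2) :
    ∃ ω : ℤ, w = (q : ℤ) ^ (e / 2) * ω ∧ ¬ (q : ℤ) ∣ ω ∧ e = 2 * (e / 2) ∧
      (q : ℤ) ∣ ω ^ 2 - D₀ * u ^ 2 := by
  haveI := Fact.mk hq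
  have hqZ : Prime (q : ℤ) := Nat.prime_iff_prime_int.mp hq
  have hDu : ¬ (q : ℤ) ∣ D₀ * u ^ 2 := fun h' => by
    rcases hqZ.dvd_or_dvd h' with h' | h'
    · exact hD₀ h'
    · exact hu (hqZ.dvd_of_dvd_pow h')
  -- `w ≠ 0`
  have hw : w ≠ 0 := by
    rintro rfl
    have h1 : (q : ℤ) ^ (e + 1) ∣ (q : ℤ) ^ e * D₀ * u ^ 2 := by
      have := (pow_dvd_pow (q : ℤ) (Nat.succ_le_of_lt hen)).trans h
      simpa [dvd_neg, mul_assoc] using this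
    rw [pow_succ, mul_assoc] at h1
    exact hDu ((mul_dvd_mul_iff_left (pow_ne_zero e hqZ.ne_zero)).mp h1)
  set j := padicValInt q w with hj
  obtain ⟨ω, hω⟩ := padicValInt_dvd (p := q) w
  rw [← hj] at hω
  have hωq : ¬ (q : ℤ) ∣ ω := by
    intro h'
    have : (q : ℤ) ^ (j + 1) ∣ w := by
      rw [hω, pow_succ]
      exact mul_dvd_mul_left _ h'
    rcases (padicValInt_dvd_iff (j + 1) w).mp this with h'' | h''
    · exact hw h''
    · omega
  -- `2 j = e`
  have h2j : 2 * j = e := by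
    rcases Nat.lt_or_ge (2 * j) e with hlt | hge
    · -- `2j < e`: then `q ∣ ω`
      exfalso
      have h1 : (q : ℤ) ^ (2 * j + 1) ∣ w ^ 2 := by
        have ha : (q : ℤ) ^ (2 * j + 1) ∣ (q : ℤ) ^ e * D₀ * u ^ 2 :=
          dvd_mul_of_dvd_left (dvd_mul_of_dvd_left (pow_dvd_pow _ (by omega)) _) _
        have hb : (q : ℤ) ^ (2 * j + 1) ∣ w ^ 2 - (q : ℤ) ^ e * D₀ * u ^ 2 :=
          (pow_dvd_pow _ (by omega)).trans h
        simpa using dvd_add hb ha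
      rw [hω, mul_pow, ← pow_mul, mul_comm j 2, pow_succ] at h1
      have h2 : (q : ℤ) ∣ ω ^ 2 :=
        (mul_dvd_mul_iff_left (pow_ne_zero _ hqZ.ne_zero)).mp h1
      exact hωq (hqZ.dvd_of_dvd_pow h2)
    · rcases hge.eq_or_lt with heq | hgt
      · exact heq.symm
      · -- `2j > e`: then `q ∣ D₀ u²`
        exfalso
        have h1 : (q : ℤ) ^ (e + 1) ∣ w ^ 2 := by
          rw [hω, mul_pow, ← pow_mul]
          exact dvd_mul_of_dvd_left (pow_dvd_pow _ (by omega)) _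
        have hb : (q : ℤ) ^ (e + 1) ∣ w ^ 2 - (q : ℤ) ^ e * D₀ * u ^ 2 :=
          (pow_dvd_pow _ (by omega)).trans h
        have h3 : (q : ℤ) ^ (e + 1) ∣ (q : ℤ) ^ e * (D₀ * u ^ 2) := by
          have := dvd_sub h1 hb
          simpa [mul_assoc] using this
        rw [pow_succ] at h3
        exact hDu ((mul_dvd_mul_iff_left (pow_ne_zero e hqZ.ne_zero)).mp h3)
  have he2 : e / 2 = j := by omega
  refine ⟨ω, by rw [he2]; exact hω, hωq, by omega, ?_⟩
  -- `ω² ≡ D₀ u² (mod q)`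
  have h1 : (q : ℤ) ^ (e + 1) ∣ (q : ℤ) ^ e * (ω ^ 2 - D₀ * u ^ 2) := by
    have hb : (q : ℤ) ^ (e + 1) ∣ w ^ 2 - (q : ℤ) ^ e * D₀ * u ^ 2 :=
      (pow_dvd_pow _ (by omega)).trans h
    have : w ^ 2 - (q : ℤ) ^ e * D₀ * u ^ 2 = (q : ℤ) ^ e * (ω ^ 2 - D₀ * u ^ 2) := by
      rw [hω, mul_pow, ← pow_mul, mul_comm j 2, h2j]; ring
    rwa [this] at hb
  rw [pow_succ] at h1
  exact (mul_dvd_mul_iff_left (pow_ne_zero e hqZ.ne_zero)).mp h1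

/-! ### The class bit: which square root

The one-bit class datum `bit ω u` of a pair `(ω, u)` of `q`-units is, for odd `q`, on which side of
`q/2` the residue `ω/u mod q` lies (this separates the two square roots `±ρ` of a unit) and, for
`q = 2`, whether `ω ≡ u (mod 4)`. No definition is introduced: the statements take a function `bit`
together with the hypothesis `hbit_def` that it is this function. -/

/-- Brute force modulo `4`: for odd `ω, u, ω', u'` with `ω ≡ u ↔ ω' ≡ u' (mod 4)`,
`u'ω + uω' ≡ 2 (mod 4)`. [folklore] -/
theorem zmod_four_sum_eq_two : ∀ ω u ω' u' : ZMod 4, ω ^ 2 = 1 → u ^ 2 = 1 → ω' ^ 2 = 1 →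
    u' ^ 2 = 1 → ((ω = u) ↔ (ω' = u')) → u' * ω + u * ω' = 2 := by
  decide

/-- An odd integer squares to `1` modulo `4`. [folklore] -/
theorem zmod_four_sq_eq_one {z : ℤ} (hz : ¬ (2 : ℤ) ∣ z) : ((z : ZMod 4)) ^ 2 = 1 := by
  have hodd : Odd z := Int.not_even_iff_odd.mp (fun h => hz (even_iff_two_dvd.mp h))
  obtain ⟨t, rfl⟩ := hodd
  have h4 : (4 : ZMod 4) = 0 := rfl
  push_cast
  linear_combination (t + t ^ 2) * h4

/-- The key property of the root bit: for `q`-units `ω, u, ω', u'` with `ω² ≡ D₀u²`, `ω'² ≡ D₀u'² (mod q)`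
and equal bits, `u'ω + uω'` has the least possible `q`-valuation `[q = 2]`. [folklore] -/
theorem sum_eq_of_rootBit_eq {q : ℕ} (hq : q.Prime) (bit : ℤ → ℤ → Bool)
    (hbit_def : ∀ ω u, bit ω u = if q = 2 then decide ((4 : ℤ) ∣ ω - u)
      else decide ((((ω : ZMod q) * ((u : ZMod q))⁻¹).val) ≤ q / 2))
    {ω u ω' u' D₀ : ℤ}
    (hω : ¬ (q : ℤ) ∣ ω) (hu : ¬ (q : ℤ) ∣ u) (hω' : ¬ (q : ℤ) ∣ ω') (hu' : ¬ (q : ℤ) ∣ u')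
    (hsq : (q : ℤ) ∣ ω ^ 2 - D₀ * u ^ 2) (hsq' : (q : ℤ) ∣ ω' ^ 2 - D₀ * u' ^ 2)
    (hbit : bit ω u = bit ω' u') :
    ∃ L₀ : ℤ, u' * ω + u * ω' = (if q = 2 then 2 else 1) * L₀ ∧ ¬ (q : ℤ) ∣ L₀ := by
  rw [hbit_def, hbit_def] at hbit
  by_cases hq2 : q = 2
  · subst hq2
    simp only [if_true, decide_eq_decide] at hbit
    have key := zmod_four_sum_eq_two (ω : ZMod 4) u ω' u' (zmod_four_sq_eq_one hω)
      (zmod_four_sq_eq_one hu) (zmod_four_sq_eq_one hω') (zmod_four_sq_eq_one hu') (by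
        rw [ZMod.intCast_eq_intCast_iff_dvd_sub, ZMod.intCast_eq_intCast_iff_dvd_sub]
        push_cast
        rw [dvd_sub_comm, hbit, dvd_sub_comm])
    have h2 : ((2 : ℤ) : ZMod 4) = ((u' * ω + u * ω' : ℤ) : ZMod 4) := by push_cast; rw [key]
    rw [ZMod.intCast_eq_intCast_iff_dvd_sub] at h2
    obtain ⟨t, ht⟩ := h2
    refine ⟨1 + 2 * t, ?_, ?_⟩
    · push_cast; linear_combination ht
    · push_cast; omega
  · haveI := Fact.mk hq
    simp only [hq2, if_false, decide_eq_decide] at hbit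
    refine ⟨u' * ω + u * ω', by simp [hq2], ?_⟩
    rw [← ZMod.intCast_zmod_eq_zero_iff_dvd] at hω hu hω' hu' ⊢
    push_cast
    have hsqZ : ((ω : ZMod q)) ^ 2 = (D₀ : ZMod q) * (u : ZMod q) ^ 2 := by
      have h := (ZMod.intCast_zmod_eq_zero_iff_dvd _ q).mpr hsq
      push_cast at h
      linear_combination h
    have hsqZ' : ((ω' : ZMod q)) ^ 2 = (D₀ : ZMod q) * (u' : ZMod q) ^ 2 := by
      have h := (ZMod.intCast_zmod_eq_zero_iff_dvd _ q).mpr hsq'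
      push_cast at h
      linear_combination h
    set Ω : ZMod q := (ω : ZMod q) * ((u : ZMod q))⁻¹ with hΩ
    set Ω' : ZMod q := (ω' : ZMod q) * ((u' : ZMod q))⁻¹ with hΩ'
    have hΩu : Ω * u = ω := by rw [hΩ]; field_simp
    have hΩu' : Ω' * u' = ω' := by rw [hΩ']; field_simp
    have hΩ0 : Ω ≠ 0 := by
      intro h0
      rw [h0, zero_mul] at hΩu
      exact hω hΩu.symm
    have hΩsq : Ω ^ 2 = Ω' ^ 2 := by
      have h1 : Ω ^ 2 * (u : ZMod q) ^ 2 = (D₀ : ZMod q) * (u : ZMod q) ^ 2 := by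
        rw [← mul_pow, hΩu, hsqZ]
      have h2 : Ω' ^ 2 * (u' : ZMod q) ^ 2 = (D₀ : ZMod q) * (u' : ZMod q) ^ 2 := by
        rw [← mul_pow, hΩu', hsqZ']
      have h1' : Ω ^ 2 = (D₀ : ZMod q) :=
        mul_right_cancel₀ (pow_ne_zero 2 hu) h1
      have h2' : Ω' ^ 2 = (D₀ : ZMod q) :=
        mul_right_cancel₀ (pow_ne_zero 2 hu') h2
      rw [h1', h2']
    have hΩeq : Ω = Ω' := by
      have h0 : (Ω - Ω') * (Ω + Ω') = 0 := by linear_combination hΩsq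
      rcases mul_eq_zero.mp h0 with h | h
      · linear_combination h
      · exfalso
        have hneg : Ω' = -Ω := by linear_combination h
        rw [hneg, ZMod.neg_val, if_neg hΩ0] at hbit
        have hlt := ZMod.val_lt Ω
        have hpos : 0 < Ω.val := (ZMod.val_pos).mpr hΩ0
        have hodd : q % 2 = 1 := hq.eq_two_or_odd.resolve_left hq2
        omega
    intro hsum
    have h2 : (2 : ZMod q) * Ω * (u : ZMod q) * (u' : ZMod q) = 0 := by
      calc (2 : ZMod q) * Ω * (u : ZMod q) * (u' : ZMod q)
          = (u' : ZMod q) * (Ω * u) + u * (Ω' * u') := by rw [hΩeq]; ring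
        _ = 0 := by rw [hΩu, hΩu', hsum]
    simp only [mul_eq_zero] at h2
    rcases h2 with ((h2 | h2) | h2) | h2
    · apply hq2
      have h2' : ((2 : ℕ) : ZMod q) = 0 := by exact_mod_cast h2
      rw [ZMod.natCast_eq_zero_iff] at h2'
      exact ((Nat.prime_dvd_prime_iff_eq hq Nat.prime_two).mp h2').symm ▸ rfl
    · exact hΩ0 h2
    · exact hu h2
    · exact hu' h2

/-! ### Two approximate roots in the same class -/

/-- The binary step: if `q^n ∣ H(u)`, `q^n ∣ H(v)` (`n > e`, `b² - ad = q^e D₀`, `q ∤ D₀`) with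
`u₁, v₁` units modulo `q` and equal bits, then `q^{n - e/2 - [q=2]} ∣ u₀v₁ - v₀u₁`. [folklore] -/
theorem binary_minor_dvd {q : ℕ} (hq : q.Prime) (bit : ℤ → ℤ → Bool)
    (hbit_def : ∀ ω u, bit ω u = if q = 2 then decide ((4 : ℤ) ∣ ω - u)
      else decide ((((ω : ZMod q) * ((u : ZMod q))⁻¹).val) ≤ q / 2))
    (a b d D₀ : ℤ) {e n : ℕ}
    (hD : b ^ 2 - a * d = (q : ℤ) ^ e * D₀) (hD₀ : ¬ (q : ℤ) ∣ D₀) (hen : e < n)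
    {u₀ u₁ v₀ v₁ : ℤ} (hu : ¬ (q : ℤ) ∣ u₁) (hv : ¬ (q : ℤ) ∣ v₁)
    (hHu : (q : ℤ) ^ n ∣ a * u₀ ^ 2 + 2 * b * u₀ * u₁ + d * u₁ ^ 2)
    (hHv : (q : ℤ) ^ n ∣ a * v₀ ^ 2 + 2 * b * v₀ * v₁ + d * v₁ ^ 2)
    (hbit : bit ((a * u₀ + b * u₁) / (q : ℤ) ^ (e / 2)) u₁
      = bit ((a * v₀ + b * v₁) / (q : ℤ) ^ (e / 2)) v₁) :
    (q : ℤ) ^ (n - e / 2 - (if q = 2 then 1 else 0)) ∣ u₀ * v₁ - v₀ * u₁ := by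
  have hqZ : Prime (q : ℤ) := Nat.prime_iff_prime_int.mp hq
  have hwu : (q : ℤ) ^ n ∣ (a * u₀ + b * u₁) ^ 2 - (q : ℤ) ^ e * D₀ * u₁ ^ 2 := by
    have h := dvd_mul_of_dvd_right hHu a
    rwa [binary_complete_square, hD] at h
  have hwv : (q : ℤ) ^ n ∣ (a * v₀ + b * v₁) ^ 2 - (q : ℤ) ^ e * D₀ * v₁ ^ 2 := by
    have h := dvd_mul_of_dvd_right hHv a
    rwa [binary_complete_square, hD] at h
  obtain ⟨ω, hω, hωq, -, hωsq⟩ := exists_eq_pow_mul_of_sq_congr hq hen hD₀ hu hwu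
  obtain ⟨ω', hω', hωq', -, hωsq'⟩ := exists_eq_pow_mul_of_sq_congr hq hen hD₀ hv hwv
  have hqe : ((q : ℤ) ^ (e / 2)) ≠ 0 := pow_ne_zero _ hqZ.ne_zero
  rw [hω, Int.mul_ediv_cancel_left _ hqe, hω', Int.mul_ediv_cancel_left _ hqe] at hbit
  obtain ⟨L₀, hL, hL₀⟩ := sum_eq_of_rootBit_eq hq bit hbit_def hωq hu hωq' hv hωsq hωsq' hbit
  have hlhs : (q : ℤ) ^ n ∣ (a * u₀ ^ 2 + 2 * b * u₀ * u₁ + d * u₁ ^ 2) * v₁ ^ 2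
      - (a * v₀ ^ 2 + 2 * b * v₀ * v₁ + d * v₁ ^ 2) * u₁ ^ 2 :=
    dvd_sub (dvd_mul_of_dvd_left hHu _) (dvd_mul_of_dvd_left hHv _)
  rw [binary_polar_identity, hω, hω'] at hlhs
  set h := e / 2 with hh
  set ν : ℕ := if q = 2 then 1 else 0 with hν
  have hc : (if q = 2 then (2 : ℤ) else 1) = (q : ℤ) ^ ν := by
    by_cases hq2 : q = 2
    · subst hq2; simp [hν]
    · simp [hν, hq2]
  have hfac : v₁ * ((q : ℤ) ^ h * ω) + u₁ * ((q : ℤ) ^ h * ω')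
      = (q : ℤ) ^ (h + ν) * L₀ := by
    rw [pow_add, ← hc]
    linear_combination (q : ℤ) ^ h * hL
  rw [hfac] at hlhs
  by_cases hle : h + ν ≤ n
  · obtain ⟨t, ht⟩ : ∃ t, n = (h + ν) + t := ⟨n - (h + ν), by omega⟩
    have hdvd : (q : ℤ) ^ t ∣ (u₀ * v₁ - v₀ * u₁) * L₀ := by
      rw [ht, pow_add] at hlhs
      have h' : (q : ℤ) ^ (h + ν) * (q : ℤ) ^ t
          ∣ (q : ℤ) ^ (h + ν) * ((u₀ * v₁ - v₀ * u₁) * L₀) := by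
        have : (u₀ * v₁ - v₀ * u₁) * ((q : ℤ) ^ (h + ν) * L₀)
            = (q : ℤ) ^ (h + ν) * ((u₀ * v₁ - v₀ * u₁) * L₀) := by ring
        rwa [this] at hlhs
      exact (mul_dvd_mul_iff_left (pow_ne_zero _ hqZ.ne_zero)).mp h'
    have ht' : n - h - ν = t := by omega
    rw [ht']
    exact hqZ.pow_dvd_of_dvd_mul_right t hL₀ hdvd
  · have h0 : n - h - ν = 0 := by omega
    rw [h0, pow_zero]
    exact one_dvd _

end TernaryConic

end Literature.NumberTheory.DiophantineGeometry
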